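/-
Origin: expansion seat `prover-pub-hodgecm-mc-binder-1-g6-0`, handover #6 14:17Z md5 825463c78978 (154 l.; NEW additive KERNEL leaf, ns HodgeCM.SignRecipe + HodgeCM.Universe.AdelicThetaCore; junction (J-hW) «the regime of U(W) is forced by the context»: `SignRecipe.reqPos_self_eq` (at `τ = ι₁` the required sign is type-independent for types containing `ι₁ ∘ j`: `kappa_self_false/true` + the CM-type axiom), `re_pos_iff_of_goodCtx` (all four `a_i` have the same sign at `ι₁` under `SignRecipe.GoodCtx h ι₁ c`: `forced` + `mem`), `im_embedding_a`/`re_embedding_a_ne_zero` (`a_real`, `a_ne`), `posDef_diagonal_map`, `isAnisotropic_neg_iff`, `isAnisotropic_diagonal_of_sameSign` (definite at `ι₁` ⇒ anisotropic, `isAnisotropic_of_posDef`), **`SignRecipe.isAnisotropic_gramW_of_goodCtx : SignRecipe.GoodCtx h ι₁ c → IsAnisotropic L c.D.gramW`** (+ `gramW'`), **`AdelicThetaCore.isAnisotropic_gramW_of_goodCtx : (C.thetaModel h d12 d34).GoodCtx ι₁ c → IsAnisotropic L c.D.gramW`** for ANY core (+ `gramW'`; `thetaModel_goodCtx_iff`)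 — discharges the regime hypothesis `hW` of rows #3–#5 at every good context of the END STATE. 0 Prop defs, nothing cited, MODEL-N ±0, E unchanged. EVIDENCE: farm rc 0 / 0 warnings 36 s (`farm/build-hw.log`), `#print axioms` 11/11 ⊆ trio (`farm/ax_hw.log`), FQN clash grep 0, no `proof-hole`/`adm-token`.) (`HOME/mc/pub-hodgecm-mc-binder-1-g6/stage/HodgeCM/Model/Binders/GramWRegime.lean`, md5 825463c7, 154 lines);
landed by the gen-12 packager (p-g12) in gate run 36 as `HodgeCM/Model/Binders/GramWRegime.lean` (verbatim).
-/
/-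
Origin: speedrun cell pub-hodgecm, MODEL-CONSTRUCTION sub-cell, unit pub-hodgecm-mc-binder-1-g6 (BINDER PROVER, gen 6; node
B2-meet, junction (J-hW) «the regime of U(W) is forced by the context»), seat prover-pub-hodgecm-mc-binder-1-g6-0, 2026-08-19.
Target in PKG: HodgeCM/Model/Binders/GramWRegime.lean (NEW additive leaf; imports `Automorphic/EndStateFieldCensus`,
`Automorphic/AdelicTorusThetaData`; nothing landed imports it).  KERNEL ONLY: 0 records, nothing cited, MODEL-N 0.
-/
import Summits.HodgeConjecture.HodgeCM.Automorphic.EndStateFieldCensus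
import Summits.HodgeConjecture.HodgeCM.Automorphic.AdelicTorusThetaData_2

/-!
# (J-hW): a good context forces `W = W₁ ⊕ W₂` (and `W₃ ⊕ W₄`) to be ANISOTROPIC

The binder files `Binders/Gen12TorusCurrency`, `Gen12TorusPeriodW`, `MeetBridgesSeesaw` read the (12) torus of the END STATE on
adelic matrices under the regime hypothesis `hW : IsAnisotropic L c.D.gramW` (`subtype_jT₁₂Model_apply`; outside the regime the
PKG device `regimeSubgroup L c.D.gramW` is trivial).  This file discharges `hW` from the context's guard: under PerL's forced signs
(`GoodCtx.forced`, Def 3.2, tex ll. 299–304) and `σ ∈ Ψ_i` for all four types (`GoodCtx.mem`), ALL FOUR lines `a_i` have the same sign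
at the distinguished embedding `ι₁` — the required sign `reqPos h K L j ι₁ (Ψ i) ι₁` does not depend on `i`, because `κ(ι₁) = σ` (recipe
bit `false`, `kappa_self_false`) resp. `σ̄` (`true`, `kappa_self_true`) lies in every `Ψ_i` resp. in none — so `diag(a₀, a₁)` is
DEFINITE at `ι₁`, hence anisotropic (`isAnisotropic_of_posDef`).

* `SignRecipe.reqPos_self_eq` — `reqPos h K L j ι₁ (Ψ i) ι₁ = reqPos h K L j ι₁ (Ψ i') ι₁` whenever `ι₁ ∘ j ∈ Ψ i ∩ Ψ i'`;
* `SignRecipe.re_pos_iff_of_goodCtx` — under `SignRecipe.GoodCtx h ι₁ c`: `0 < Re ι₁(a_i) ↔ 0 < Re ι₁(a_i')`;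
* **`SignRecipe.isAnisotropic_gramW_of_goodCtx`**, `…_gramW'_…` — `IsAnisotropic L c.D.gramW` (and `gramW'`);
* **`AdelicThetaCore.isAnisotropic_gramW_of_goodCtx`** — the same from the END STATE's own guard `(C.thetaModel h d12 d34).GoodCtx ι₁ c`
  (`thetaModel_goodCtx_iff`), for ANY core `C` — in particular at the pin of E.
-/

set_option autoImplicit false

noncomputable section

open NumberField NumberField.ComplexEmbedding
open scoped ComplexOrder

namespace HodgeCM

open Literature.AlgebraicGeometry.ShimuraVarieties (conjRingHomK embedding_conjRingHomK)

namespace SignRecipe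

variable (h : Bool) {K L : CMField} (j : K →+* L) (ι₁ : L →+* ℂ)

/-- At `τ = ι₁` the required sign of a line does not depend on its type, as long as the type contains `ι₁ ∘ j`. -/
theorem reqPos_self_eq {Ψ Ψ' : Literature.AlgebraicGeometry.Motives.CMType K}
    (hΨ : ι₁.comp j ∈ Ψ.1) (hΨ' : ι₁.comp j ∈ Ψ'.1) :
    reqPos h K L j ι₁ Ψ ι₁ = reqPos h K L j ι₁ Ψ' ι₁ := by
  have hc : conjugate (ι₁.comp j) ∉ Ψ.1 := (Ψ.2 _).mp hΨ
  have hc' : conjugate (ι₁.comp j) ∉ Ψ'.1 := (Ψ'.2 _).mp hΨ'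
  cases h
  · simp only [reqPos, kappa_self_false, ind, hΨ, hΨ', if_true]
  · simp only [reqPos, kappa_self_true, ind, hc, hc', if_false]

variable {h ι₁}

/-- Under a good context all four lines have the same sign at `ι₁`. -/
theorem re_pos_iff_of_goodCtx {c : SeesawCtx L} (hc : SignRecipe.GoodCtx h ι₁ c) (i i' : Fin 4) :
    0 < (ι₁ (c.D.a i)).re ↔ 0 < (ι₁ (c.D.a i')).re := by
  obtain ⟨j, hj, hS⟩ := hc.forced
  have hm : ∀ k, ι₁.comp j ∈ (c.Ψ k).1 := fun k => hj ▸ hc.mem k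
  rw [hS i ι₁, hS i' ι₁, reqPos_self_eq h j ι₁ (hm i) (hm i')]

/-- A line discriminant is real at every embedding. -/
theorem im_embedding_a (c : SeesawCtx L) (τ : L →+* ℂ) (i : Fin 4) : (τ (c.D.a i)).im = 0 := by
  have h1 : τ (conjRingHomK L (c.D.a i)) = τ (c.D.a i) := by rw [c.D.a_real i]
  rw [embedding_conjRingHomK] at h1
  have h2 := congrArg Complex.im h1
  rw [Complex.conj_im] at h2
  linarith

/-- (Ported verbatim from the HodgeCMPerL package; no docstring in the source.) -/
theorem re_embedding_a_ne_zero (c : SeesawCtx L) (τ : L →+* ℂ) (i : Fin 4) : (τ (c.D.a i)).re ≠ 0 := by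
  intro h0
  apply c.D.a_ne i
  apply τ.injective
  rw [map_zero]
  exact Complex.ext h0 (im_embedding_a c τ i)

/-- A diagonal `2 × 2` form whose two entries are positive reals at `τ` is positive definite at `τ`. -/
theorem posDef_diagonal_map {a b : L} (τ : L →+* ℂ) (ha : 0 < τ a) (hb : 0 < τ b) :
    ((Matrix.diagonal ![a, b]).map τ).PosDef := by
  rw [Matrix.diagonal_map (map_zero τ)]
  refine Matrix.PosDef.diagonal fun i => ?_
  fin_cases i
  · simpa using ha
  · simpa using hb

/-- anisotropy is insensitive to the sign of the form -/
theorem isAnisotropic_neg_iff {n : Type} [Fintype n] (H : Matrix n n L) : IsAnisotropic L (-H) ↔ IsAnisotropic L H := by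
  have key : ∀ x : n → L, Literature.AlgebraicGeometry.ShimuraVarieties.hermForm (conjRingHomK L) (-H) x x =
      -Literature.AlgebraicGeometry.ShimuraVarieties.hermForm (conjRingHomK L) H x x := by
    intro x
    simp only [Literature.AlgebraicGeometry.ShimuraVarieties.hermForm, Matrix.neg_mulVec, dotProduct_neg]
  constructor
  · intro hA x hx
    exact hA x (by rw [key, hx, neg_zero])
  · intro hA x hx
    exact hA x (by rw [key, neg_eq_zero] at hx; exact hx)

/-- The common-sign dichotomy gives anisotropy of `diag(a_i, a_i')`. -/
theorem isAnisotropic_diagonal_of_sameSign (c : SeesawCtx L) (ι₁ : L →+* ℂ) (i i' : Fin 4)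
    (hs : 0 < (ι₁ (c.D.a i)).re ↔ 0 < (ι₁ (c.D.a i')).re) :
    IsAnisotropic L (Matrix.diagonal ![c.D.a i, c.D.a i']) := by
  by_cases hpos : 0 < (ι₁ (c.D.a i)).re
  · -- positive definite at `ι₁`
    refine isAnisotropic_of_posDef L _ ι₁ (posDef_diagonal_map ι₁ ?_ ?_)
    · exact Complex.lt_def.mpr ⟨by rwa [Complex.zero_re], by rw [Complex.zero_im, im_embedding_a c ι₁ i]⟩
    · exact Complex.lt_def.mpr ⟨by rw [Complex.zero_re]; exact hs.mp hpos, by rw [Complex.zero_im, im_embedding_a c ι₁ i']⟩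
  · -- negative definite at `ι₁`: `-diag` is positive definite
    have hneg : (ι₁ (c.D.a i)).re < 0 := lt_of_le_of_ne (not_lt.mp hpos) (re_embedding_a_ne_zero c ι₁ i)
    have hneg' : (ι₁ (c.D.a i')).re < 0 :=
      lt_of_le_of_ne (not_lt.mp fun h' => hpos (hs.mpr h')) (re_embedding_a_ne_zero c ι₁ i')
    rw [← isAnisotropic_neg_iff]
    have hd : -(Matrix.diagonal ![c.D.a i, c.D.a i']) = Matrix.diagonal ![-c.D.a i, -c.D.a i'] := by
      rw [Matrix.diagonal_neg]
      congr 1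
      funext k
      fin_cases k <;> rfl
    rw [hd]
    refine isAnisotropic_of_posDef L _ ι₁ (posDef_diagonal_map ι₁ ?_ ?_)
    · rw [map_neg]
      exact Complex.lt_def.mpr ⟨by rw [Complex.zero_re, Complex.neg_re]; linarith,
        by rw [Complex.zero_im, Complex.neg_im, im_embedding_a c ι₁ i, neg_zero]⟩
    · rw [map_neg]
      exact Complex.lt_def.mpr ⟨by rw [Complex.zero_re, Complex.neg_re]; linarith,
        by rw [Complex.zero_im, Complex.neg_im, im_embedding_a c ι₁ i', neg_zero]⟩

/-- **(J-hW)**: under PerL's model-free good-context guard, `W = W₁ ⊕ W₂ = ⟨a₀⟩ ⊕ ⟨a₁⟩` is anisotropic. -/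
theorem isAnisotropic_gramW_of_goodCtx {c : SeesawCtx L} (hc : SignRecipe.GoodCtx h ι₁ c) : IsAnisotropic L c.D.gramW :=
  isAnisotropic_diagonal_of_sameSign c ι₁ 0 1 (re_pos_iff_of_goodCtx hc 0 1)

/-- … and so is `W₃ ⊕ W₄ = ⟨a₂⟩ ⊕ ⟨a₃⟩`. -/
theorem isAnisotropic_gramW'_of_goodCtx {c : SeesawCtx L} (hc : SignRecipe.GoodCtx h ι₁ c) : IsAnisotropic L c.D.gramW' :=
  isAnisotropic_diagonal_of_sameSign c ι₁ 2 3 (re_pos_iff_of_goodCtx hc 2 3)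

end SignRecipe

namespace Universe.AdelicThetaCore

variable {U : Universe} {hP : PrintFact_unitaryCompact} (C : U.AdelicThetaCore hP) (h : Bool)
  (d12 d34 : ∀ {L : CMField}, SeesawCtx L → SideData L)

/-- **(J-hW) for the END STATE of ANY core** (in particular at the pin of E): its good-context guard forces the regime of `U(W)`. -/
theorem isAnisotropic_gramW_of_goodCtx {L : CMField} {ι₁ : L →+* ℂ} {c : SeesawCtx L}
    (hc : (C.thetaModel h d12 d34).GoodCtx ι₁ c) : IsAnisotropic L c.D.gramW :=
  SignRecipe.isAnisotropic_gramW_of_goodCtx ((C.thetaModel_goodCtx_iff h d12 d34 ι₁ c).mp hc)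

/-- (Ported verbatim from the HodgeCMPerL package; no docstring in the source.) -/
theorem isAnisotropic_gramW'_of_goodCtx {L : CMField} {ι₁ : L →+* ℂ} {c : SeesawCtx L}
    (hc : (C.thetaModel h d12 d34).GoodCtx ι₁ c) : IsAnisotropic L c.D.gramW' :=
  SignRecipe.isAnisotropic_gramW'_of_goodCtx ((C.thetaModel_goodCtx_iff h d12 d34 ι₁ c).mp hc)

end Universe.AdelicThetaCore

end HodgeCM

end
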